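import Summits.MatrixMultiplication.OmegaCensus.STPP222GLNormalForm
import HarnessLib

/-!
# (1,2,2)^k STPP families in (ℤ/p)³: the AFFINE NORMAL FORM is without loss of generality, and the ROOM set is invariant (kernel)

Cell `pub-omega` (unit `pub-omega-stpp-1-g34`), topic `Summits/MatrixMultiplication/OmegaCensus`.
HONEST FRAMING (verbatim): lottery ticket; floor = certified bounds/negative ranges. Census STRUCTURE bookkeeping (row B5 / C10, the
threshold column `T2(H) = max {k : (1,2,2)^k ⊆ H}` at the elementary types `(ℤ/3)ⁿ`); nothing here is a bound on `ω`.

WHAT IS PROVED (for `V = ℤ/p × ℤ/p × ℤ/p`, `p` prime, families of `k+1` triples with `|Aᵢ| = 1`, `|Bᵢ| = |Cᵢ| = 2`):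
* `GLNF.diffSet A B C = (⋃ᵢ (Bᵢ − Aᵢ)) − (⋃ᵢ (Cᵢ − Aᵢ))` — the set of differences whose COMPLEMENT is the «room» a further triple needs: a new
  triple `({a}, B', C')` extending an STPP family must have `(B' − a) − (C' − a)` (4 points) inside the complement (`GLNF.diffSet_mono` is the
  monotonicity half; the disjointness half is the mechanism sentence of X-38 / C10 at `(3, 27)` and is NOT proved in this file);
* its cardinality is invariant under the three STPP symmetries of the tree — per-member translation (`IsSTPP.translate`), global `B`/`C`
  shifts (`IsSTPP.shiftBC`), automorphisms (`IsSTPP.map_addEquiv`) — : `card_diffSet_translate`, `card_diffSet_shiftBC`, `card_diffSet_map`;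
* `GLNF.exists_nf122` — **every `(1,2,2)^{k+1}` STPP family is equivalent (same cards, same `#diffSet`) to one in AFFINE NORMAL FORM (spelled out in the statements, no predicate is introduced):
  `Aᵢ = {0}` for all `i`, `B₀ = {0, e₁}`, `C₀ = {0, c}` with `c ≠ 0, ±e₁` and (`c = e₂` or `c ∈ ⟨e₁⟩`)**; at `p = 3` the line case is empty, so
  `C₀ = {0, e₂}` (`GLNF.exists_nf122_three`). The `GL₃(𝔽_p)` facts are ENG1 gen 29's explicit shears (`exists_map_eq_e1`,
  `exists_fix_e1_map_eq_e2`, `STPP222GLNormalFormMaps.lean`); the condition `c ≠ ±e₁` is the TPP of triple `0`.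
This is the WLOG half of the rank-3 mechanism item (lead ruling L40-13); the `decide` half (every normal-form `(1,2,2)³` family of `(ℤ/3)³`
has `#diffSet ≥ 24`) is a separate file. References: H. Cohn, R. Kleinberg, B. Szegedy, C. Umans, FOCS 2005 (arXiv:math/0511460), Def. 5.1.
-/

namespace Summit.MatrixMultiplication.OmegaCensus

open Finset Pointwise Literature.Computability.AlgebraicComplexity

namespace GLNF

variable {p : ℕ} {k : ℕ}

/-! ## The pattern and the room set -/

/-- The DIFFERENCE SET of a family: `(⋃ᵢ (Bᵢ − Aᵢ)) − (⋃ᵢ (Cᵢ − Aᵢ))` (for `Aᵢ = {0}` this is `(⋃ Bᵢ) − (⋃ Cᵢ)`; its complement in `V`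
is the room left for the sumset of a further triple). -/
def diffSet (A B C : Fin (k + 1) → Finset (V p)) : Finset (V p) :=
  (univ.biUnion fun i => B i - A i) - (univ.biUnion fun i => C i - A i)

/-- Membership in the difference set. -/
theorem mem_diffSet {A B C : Fin (k + 1) → Finset (V p)} {x : V p} :
    x ∈ diffSet A B C ↔ ∃ i j, ∃ b ∈ B i, ∃ a ∈ A i, ∃ c ∈ C j, ∃ a' ∈ A j, x = (b - a) - (c - a') := by
  simp only [diffSet, mem_sub, mem_biUnion, mem_univ, true_and]
  constructor
  · rintro ⟨y, ⟨i, b, hb, a, ha, rfl⟩, z, ⟨j, c, hc, a', ha', rfl⟩, rfl⟩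
    exact ⟨i, j, b, hb, a, ha, c, hc, a', ha', rfl⟩
  · rintro ⟨i, j, b, hb, a, ha, c, hc, a', ha', rfl⟩
    exact ⟨b - a, ⟨i, b, hb, a, ha, rfl⟩, c - a', ⟨j, c, hc, a', ha', rfl⟩, rfl⟩

/-- Monotonicity of the difference set in the family: dropping the last triple can only shrink it (used with `Fin.castSucc`). -/
theorem diffSet_mono {A B C : Fin (k + 2) → Finset (V p)} :
    diffSet (fun i : Fin (k + 1) => A i.castSucc) (fun i => B i.castSucc) (fun i => C i.castSucc) ⊆ diffSet A B C := by
  intro x hx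
  obtain ⟨i, j, b, hb, a, ha, c, hc, a', ha', rfl⟩ := mem_diffSet.1 hx
  exact mem_diffSet.2 ⟨i.castSucc, j.castSucc, b, hb, a, ha, c, hc, a', ha', rfl⟩

/-! ## Invariance of `#diffSet` under the three symmetries -/

/-- Translating two sets by the same vector does not change their difference set. -/
theorem image_add_sub_image_add (s t : Finset (V p)) (v : V p) :
    s.image (· + v) - t.image (· + v) = s - t := by
  ext x
  simp only [mem_sub, mem_image]
  constructor
  · rintro ⟨_, ⟨b, hb, rfl⟩, _, ⟨c, hc, rfl⟩, rfl⟩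
    exact ⟨b, hb, c, hc, by abel⟩
  · rintro ⟨b, hb, c, hc, rfl⟩
    exact ⟨b + v, ⟨b, hb, rfl⟩, c + v, ⟨c, hc, rfl⟩, by abel⟩

/-- Translating the first set translates the difference set. -/
theorem image_add_sub (s t : Finset (V p)) (v : V p) :
    s.image (· + v) - t = (s - t).image (· + v) := by
  ext x
  simp only [mem_sub, mem_image]
  constructor
  · rintro ⟨_, ⟨b, hb, rfl⟩, c, hc, rfl⟩
    exact ⟨b - c, ⟨b, hb, c, hc, rfl⟩, by abel⟩
  · rintro ⟨_, ⟨b, hb, c, hc, rfl⟩, rfl⟩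
    exact ⟨b + v, ⟨b, hb, rfl⟩, c, hc, by abel⟩

/-- Translating both sets translates the difference set by the difference of the shifts. -/
theorem image_add_sub_image_add' (s t : Finset (V p)) (v w : V p) :
    s.image (· + v) - t.image (· + w) = (s - t).image (· + (v - w)) := by
  ext x
  simp only [mem_sub, mem_image]
  constructor
  · rintro ⟨_, ⟨b, hb, rfl⟩, _, ⟨c, hc, rfl⟩, rfl⟩
    exact ⟨b - c, ⟨b, hb, c, hc, rfl⟩, by abel⟩
  · rintro ⟨_, ⟨b, hb, c, hc, rfl⟩, rfl⟩
    exact ⟨b + v, ⟨b, hb, rfl⟩, c + w, ⟨c, hc, rfl⟩, by abel⟩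

/-- `biUnion` commutes with a common translation. -/
theorem biUnion_image_add (F : Fin (k + 1) → Finset (V p)) (v : V p) :
    (univ.biUnion fun i => (F i).image (· + v)) = (univ.biUnion F).image (· + v) := by
  rw [biUnion_image]

/-- **Per-member translation leaves the difference set unchanged.** -/
theorem diffSet_translate (A B C : Fin (k + 1) → Finset (V p)) (t : Fin (k + 1) → V p) :
    diffSet (fun i => (A i).image (· + t i)) (fun i => (B i).image (· + t i)) (fun i => (C i).image (· + t i)) =
      diffSet A B C := by
  simp only [diffSet, image_add_sub_image_add]

/-- **The global `B`/`C` shifts translate the difference set** by `β − γ`. -/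
theorem diffSet_shiftBC (A B C : Fin (k + 1) → Finset (V p)) (β γ : V p) :
    diffSet A (fun i => (B i).image (· + β)) (fun i => (C i).image (· + γ)) = (diffSet A B C).image (· + (β - γ)) := by
  have hB : (fun i => (B i).image (· + β) - A i) = fun i => (B i - A i).image (· + β) := funext fun i => image_add_sub _ _ _
  have hC : (fun i => (C i).image (· + γ) - A i) = fun i => (C i - A i).image (· + γ) := funext fun i => image_add_sub _ _ _
  unfold diffSet
  rw [hB, hC, biUnion_image_add, biUnion_image_add, image_add_sub_image_add']

/-- Cardinality form of `diffSet_translate`. -/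
theorem card_diffSet_translate (A B C : Fin (k + 1) → Finset (V p)) (t : Fin (k + 1) → V p) :
    (diffSet (fun i => (A i).image (· + t i)) (fun i => (B i).image (· + t i)) (fun i => (C i).image (· + t i))).card =
      (diffSet A B C).card := by
  rw [diffSet_translate]

/-- Cardinality form of `diffSet_shiftBC`. -/
theorem card_diffSet_shiftBC (A B C : Fin (k + 1) → Finset (V p)) (β γ : V p) :
    (diffSet A (fun i => (B i).image (· + β)) (fun i => (C i).image (· + γ))).card = (diffSet A B C).card := by
  rw [diffSet_shiftBC, card_image_of_injective _ (add_left_injective _)]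

/-- An additive equivalence maps difference sets to difference sets. -/
theorem image_sub_addEquiv (φ : V p ≃+ V p) (s t : Finset (V p)) : (s - t).image φ = s.image φ - t.image φ :=
  image_image₂_distrib (map_sub φ)

/-- **An automorphism maps the difference set of a family to the difference set of the image family.** -/
theorem diffSet_map (A B C : Fin (k + 1) → Finset (V p)) (φ : V p ≃+ V p) :
    diffSet (fun i => (A i).image φ) (fun i => (B i).image φ) (fun i => (C i).image φ) = (diffSet A B C).image φ := by
  simp only [diffSet, image_sub_addEquiv, biUnion_image]

/-- Cardinality form of `diffSet_map`. -/
theorem card_diffSet_map (A B C : Fin (k + 1) → Finset (V p)) (φ : V p ≃+ V p) :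
    (diffSet (fun i => (A i).image φ) (fun i => (B i).image φ) (fun i => (C i).image φ)).card = (diffSet A B C).card := by
  rw [diffSet_map, card_image_of_injective _ φ.injective]

/-- A one-element set containing `x` is `{x}`. -/
theorem eq_singleton_of_card_one {s : Finset (V p)} (hs : s.card = 1) {x : V p} (hx : x ∈ s) : s = {x} := by
  obtain ⟨y, rfl⟩ := card_eq_one.1 hs
  rw [mem_singleton.1 hx]

/-! ## The affine normal form -/

section NormalForm

variable [Fact p.Prime]

/-- **Stage 1 (translations):** `Aᵢ = {0}` for all `i`, `0 ∈ B₀`, `0 ∈ C₀`, same cards, same `#diffSet`. -/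
theorem nf122_stage1 {A B C : Fin (k + 1) → Finset (V p)} (hS : IsSTPP A B C) (hc : ∀ i, (A i).card = 1 ∧ (B i).card = 2 ∧ (C i).card = 2) :
    ∃ A₁ B₁ C₁ : Fin (k + 1) → Finset (V p), IsSTPP A₁ B₁ C₁ ∧ (∀ i, (A₁ i).card = 1 ∧ (B₁ i).card = 2 ∧ (C₁ i).card = 2) ∧
      (diffSet A₁ B₁ C₁).card = (diffSet A B C).card ∧
      (∀ i, A₁ i = {0}) ∧ (0 : V p) ∈ B₁ 0 ∧ (0 : V p) ∈ C₁ 0 := by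
  classical
  have hne : ∀ i, (A i).Nonempty := fun i => card_pos.1 (by rw [(hc i).1]; norm_num)
  let a : Fin (k + 1) → V p := fun i => (hne i).choose
  have ha : ∀ i, A i = {a i} := fun i => eq_singleton_of_card_one (hc i).1 (hne i).choose_spec
  let t : Fin (k + 1) → V p := fun i => -a i
  have hS' := hS.translate t
  have hA' : ∀ i, (A i).image (· + t i) = {0} := fun i => by rw [ha i, image_singleton]; simp [t]
  have hBne : ((B 0).image (· + t 0)).Nonempty := by
    rw [image_nonempty]; exact card_pos.1 (by rw [(hc 0).2.1]; norm_num)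
  have hCne : ((C 0).image (· + t 0)).Nonempty := by
    rw [image_nonempty]; exact card_pos.1 (by rw [(hc 0).2.2]; norm_num)
  obtain ⟨b₀, hb₀⟩ := hBne
  obtain ⟨c₀, hc₀⟩ := hCne
  have hS'' := hS'.shiftBC (-b₀) (-c₀)
  refine ⟨_, _, _, hS'', ?_, ?_, ?_, ?_, ?_⟩
  · intro i
    refine ⟨?_, ?_, ?_⟩
    · rw [card_image_add_right]; exact (hc i).1
    · rw [card_image_add_right, card_image_add_right]; exact (hc i).2.1
    · rw [card_image_add_right, card_image_add_right]; exact (hc i).2.2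
  · rw [card_diffSet_shiftBC, card_diffSet_translate]
  · exact hA'
  · exact mem_image.2 ⟨b₀, hb₀, by simp⟩
  · exact mem_image.2 ⟨c₀, hc₀, by simp⟩

/-- The TPP of a normalised triple `({0}, {0, d}, {0, c})` inside an STPP family forbids `c = d` … -/
theorem ne_of_isSTPP_pair {A B C : Fin (k + 1) → Finset (V p)} (hS : IsSTPP A B C) {d c : V p}
    (hA : A 0 = {0}) (hB : B 0 = {0, d}) (hC : C 0 = {0, c}) (hd : d ≠ 0) : c ≠ d := by
  rintro rfl
  have h := hS 0 0 0 0 (by rw [hA]; exact mem_singleton_self _) 0 (by rw [hA]; exact mem_singleton_self _)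
    c (by rw [hB]; simp) 0 (by rw [hB]; simp) 0 (by rw [hC]; simp) c (by rw [hC]; simp) (by abel)
  exact hd h.2.2.2.1

/-- … and `c = −d`. -/
theorem ne_neg_of_isSTPP_pair {A B C : Fin (k + 1) → Finset (V p)} (hS : IsSTPP A B C) {d c : V p}
    (hA : A 0 = {0}) (hB : B 0 = {0, d}) (hC : C 0 = {0, c}) (hd : d ≠ 0) : c ≠ -d := by
  rintro rfl
  have h := hS 0 0 0 0 (by rw [hA]; exact mem_singleton_self _) 0 (by rw [hA]; exact mem_singleton_self _)
    0 (by rw [hB]; simp) d (by rw [hB]; simp) 0 (by rw [hC]; simp) (-d) (by rw [hC]; simp) (by abel)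
  exact hd h.2.2.2.1.symm

/-- **Stage 2 (an automorphism):** from stage 1 reach the affine normal form, same cards, same `#diffSet`. -/
theorem nf122_stage2 {A B C : Fin (k + 1) → Finset (V p)} (hS : IsSTPP A B C) (hc : ∀ i, (A i).card = 1 ∧ (B i).card = 2 ∧ (C i).card = 2)
    (hA : ∀ i, A i = {0}) (hB0 : (0 : V p) ∈ B 0) (hC0 : (0 : V p) ∈ C 0) :
    ∃ A₂ B₂ C₂ : Fin (k + 1) → Finset (V p), IsSTPP A₂ B₂ C₂ ∧ (∀ i, (A₂ i).card = 1 ∧ (B₂ i).card = 2 ∧ (C₂ i).card = 2) ∧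
      (diffSet A₂ B₂ C₂).card = (diffSet A B C).card ∧
      (∀ i, A₂ i = {0}) ∧ B₂ 0 = {0, e1} ∧
      ∃ c : V p, C₂ 0 = {0, c} ∧ c ≠ 0 ∧ c ≠ e1 ∧ c ≠ -e1 ∧ (c = e2 ∨ InLine c) := by
  classical
  -- B 0 = {0, d}, C 0 = {0, c'}
  obtain ⟨d, hd0, hBd⟩ := eq_pair_of_card_two (hc 0).2.1 hB0
  obtain ⟨c', hc'0, hCc⟩ := eq_pair_of_card_two (hc 0).2.2 hC0
  -- move d to e₁
  obtain ⟨φ, hφ⟩ := exists_map_eq_e1 d hd0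
  have hS₁ := hS.map_addEquiv φ
  set A₁ : Fin (k + 1) → Finset (V p) := fun i => (A i).image φ with hA₁def
  set B₁ : Fin (k + 1) → Finset (V p) := fun i => (B i).image φ with hB₁def
  set C₁ : Fin (k + 1) → Finset (V p) := fun i => (C i).image φ with hC₁def
  have hA₁ : ∀ i, A₁ i = {0} := fun i => by simp only [hA₁def, hA i, image_singleton, map_zero]
  have hB₁ : B₁ 0 = {0, e1} := by simp only [hB₁def, hBd, image_pair, map_zero, hφ]
  have hC₁ : C₁ 0 = {0, φ c'} := by simp only [hC₁def, hCc, image_pair, map_zero]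
  have hc₁ : (∀ i, (A₁ i).card = 1 ∧ (B₁ i).card = 2 ∧ (C₁ i).card = 2) := fun i =>
    ⟨by rw [hA₁def, card_image_addEquiv]; exact (hc i).1, by rw [hB₁def, card_image_addEquiv]; exact (hc i).2.1,
      by rw [hC₁def, card_image_addEquiv]; exact (hc i).2.2⟩
  have hD₁ : (diffSet A₁ B₁ C₁).card = (diffSet A B C).card := card_diffSet_map A B C φ
  have hcne0 : φ c' ≠ 0 := fun h => hc'0 (by rw [← map_zero φ] at h; exact φ.injective h)
  have e1ne : (e1 : V p) ≠ 0 := by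
    intro h; have := congrArg (fun x : V p => x.2.2) h; simp [e1] at this
  have hcne1 : φ c' ≠ e1 := ne_of_isSTPP_pair hS₁ (hA₁ 0) hB₁ hC₁ e1ne
  have hcnen : φ c' ≠ -e1 := ne_neg_of_isSTPP_pair hS₁ (hA₁ 0) hB₁ hC₁ e1ne
  by_cases hline : InLine (φ c')
  · exact ⟨A₁, B₁, C₁, hS₁, hc₁, hD₁, hA₁, hB₁, φ c', hC₁, hcne0, hcne1, hcnen, Or.inr hline⟩
  -- off the line: move φ c' to e₂ fixing e₁
  obtain ⟨ψ, hψ1, hψc⟩ := exists_fix_e1_map_eq_e2 (φ c') hline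
  have hS₂ := hS₁.map_addEquiv ψ
  refine ⟨_, _, _, hS₂, ?_, ?_, ?_⟩
  · intro i
    exact ⟨by rw [card_image_addEquiv]; exact (hc₁ i).1, by rw [card_image_addEquiv]; exact (hc₁ i).2.1,
      by rw [card_image_addEquiv]; exact (hc₁ i).2.2⟩
  · rw [card_diffSet_map, hD₁]
  · refine ⟨fun i => by simp only [hA₁ i, image_singleton, map_zero], by simp only [hB₁, image_pair, map_zero, hψ1],
      e2, by simp only [hC₁, image_pair, map_zero, hψc], ?_, ?_, ?_, Or.inl rfl⟩
    · intro h; have := congrArg (fun x : V p => x.2.1) h; simp [e2] at this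
    · intro h; have := congrArg (fun x : V p => x.2.1) h; simp [e1, e2] at this
    · intro h; have := congrArg (fun x : V p => x.2.1) h; simp [e1, e2] at this

/-- **THE AFFINE NORMAL FORM IS WITHOUT LOSS OF GENERALITY** for `(1,2,2)^{k+1}` STPP families in `(ℤ/p)³`: same cards, same size of
the difference set. [cite: CohnKleinbergSzegedyUmans2005, Def. 5.1] -/
theorem exists_nf122 {A B C : Fin (k + 1) → Finset (V p)} (hS : IsSTPP A B C) (hc : ∀ i, (A i).card = 1 ∧ (B i).card = 2 ∧ (C i).card = 2) :
    ∃ A' B' C' : Fin (k + 1) → Finset (V p), IsSTPP A' B' C' ∧ (∀ i, (A' i).card = 1 ∧ (B' i).card = 2 ∧ (C' i).card = 2) ∧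
      (diffSet A' B' C').card = (diffSet A B C).card ∧
      (∀ i, A' i = {0}) ∧ B' 0 = {0, e1} ∧
      ∃ c : V p, C' 0 = {0, c} ∧ c ≠ 0 ∧ c ≠ e1 ∧ c ≠ -e1 ∧ (c = e2 ∨ InLine c) := by
  obtain ⟨A₁, B₁, C₁, hS₁, hc₁, hD₁, hA₁, hB₁, hC₁⟩ := nf122_stage1 hS hc
  obtain ⟨A₂, B₂, C₂, hS₂, hc₂, hD₂, hN⟩ := nf122_stage2 hS₁ hc₁ hA₁ hB₁ hC₁
  exact ⟨A₂, B₂, C₂, hS₂, hc₂, hD₂.trans hD₁, hN⟩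

end NormalForm

/-- At `p = 3` the line `⟨e₁⟩` is `{0, e₁, −e₁}`, so the normal form has `C₀ = {0, e₂}` exactly. -/
theorem inLine_three {c : V 3} (h : InLine c) : c = 0 ∨ c = e1 ∨ c = -e1 := by
  obtain ⟨h1, h2⟩ := h
  have key : ∀ z : ZMod 3, ((0 : ZMod 3), (0 : ZMod 3), z) = (0 : V 3) ∨ ((0 : ZMod 3), (0 : ZMod 3), z) = (e1 : V 3) ∨
      ((0 : ZMod 3), (0 : ZMod 3), z) = -(e1 : V 3) := by decide
  have hc : c = ((0 : ZMod 3), (0 : ZMod 3), c.2.2) := by ext <;> simp [h1, h2]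
  rw [hc]; exact key c.2.2

/-- **Normal form at `p = 3`:** every `(1,2,2)^{k+1}` STPP family of `(ℤ/3)³` is equivalent (same cards, same `#diffSet`) to one with
`Aᵢ = {0}` for all `i`, `B₀ = {0, e₁}`, `C₀ = {0, e₂}`. [cite: CohnKleinbergSzegedyUmans2005, Def. 5.1] -/
theorem exists_nf122_three {A B C : Fin (k + 1) → Finset (V 3)} (hS : IsSTPP A B C) (hc : ∀ i, (A i).card = 1 ∧ (B i).card = 2 ∧ (C i).card = 2) :
    ∃ A' B' C' : Fin (k + 1) → Finset (V 3), IsSTPP A' B' C' ∧ (∀ i, (A' i).card = 1 ∧ (B' i).card = 2 ∧ (C' i).card = 2) ∧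
      (diffSet A' B' C').card = (diffSet A B C).card ∧
      (∀ i, A' i = {0}) ∧ B' 0 = {0, e1} ∧ C' 0 = {0, e2} := by
  obtain ⟨A', B', C', hS', hc', hD', hA', hB', c, hC', h0, h1, h2, hce⟩ := exists_nf122 hS hc
  refine ⟨A', B', C', hS', hc', hD', hA', hB', ?_⟩
  rcases hce with rfl | hl
  · exact hC'
  · rcases inLine_three hl with h | h | h
    · exact absurd h h0
    · exact absurd h h1
    · exact absurd h h2

end GLNF

end Summit.MatrixMultiplication.OmegaCensus
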